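import Mathlib.Analysis.Calculus.SmoothSeries
import Mathlib.Analysis.Calculus.Deriv.MeanValue
import Mathlib.Analysis.Calculus.Deriv.Inv
import Literature.Barriers.CriticalPhenomena.WeaklySAWQuadraticFlowLipschitz
import HarnessLib

/-!
# [BBS-rg-flow, Lemma 2.3]: the quadratic flow `V̄_j = (ḡ_j, z̄_j, μ̄_j)` is differentiable in the
# initial condition `g₀`, with `V̄_j' = O(χ_jḡ_j²/ḡ₀²)` ((2.33))

Sixteenth file of the series formalising [BBS-rg-flow] (Bauerschmidt–Brydges–Slade, *Structural
stability of a dynamical system near a non-hyperbolic fixed point*, AHP 16 (2015), arXiv:1211.2477),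
the abstract dynamical-system input of BBS 2015, Theorem 4.1; continuation of
`WeaklySAWCouplingFlowCutoffDeriv.lean` (`ḡ_j' = ∏_{l<j}(1 - 2β_lḡ_l) = (ḡ_j/ḡ₀)²(1 + O(ḡ₀))`,
(2.35)–(2.36)), `WeaklySAWQuadraticFlowCutoff.lean` (the series (2.14) `z̄_j = Σ_l Π^ζ_{j,l}θ_lḡ_l²`
and (2.19) `μ̄_j = -Σ_l ∏(λ_k - τ_k)⁻¹σ_l`, hypotheses `CutoffQuadHyp`) and
`WeaklySAWQuadraticFlowLipschitz.lean` ((2.33) in Lipschitz form). Source, Lemma 2.3: "For each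
`j ≥ 0`, `V̄_j = (ḡ_j, z̄_j, μ̄_j)` is twice differentiable with respect to the initial condition
`ḡ₀ > 0`, and the derivatives obey `ḡ_j' = O(ḡ_j²/ḡ₀²)`, `z̄_j' = O(χ_jḡ_j²/ḡ₀²)`,
`μ̄_j' = O(χ_jḡ_j²/ḡ₀²)` …", with its proof: "`σ_{j,l} = ∏_{k=j}^l(1 - ζ_kḡ_k)⁻¹` … `σ_{j,l}' =
σ_{j,l}Σ_{k=j}^l(1 - ζ_kḡ_k)⁻¹ζ_kḡ_k' = O(χ_jḡ_j/ḡ₀²)` … `z̄_j' = Σ_lσ_{j,l}'θ_lḡ_l² +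
2Σ_lσ_{j,l}θ_lḡ_lḡ_l' = O(χ_jḡ_j²/ḡ₀²)` … It is straightforward to justify the differentiation
under the sum … `μ̄_j' = -Σ_l(∏(λ_k - τ_k)⁻¹)(σ_l' + [σ_l]Σ_i(λ_i - τ_i)⁻¹τ_i')` … lead to the upper
bound `|μ̄_j'| ≤ O(χ_jḡ_j²ḡ₀⁻²)`." This is the differentiability clause of [BBS-rg-flow,
Proposition 1.2] and of BBS 2015, Proposition 6.1.1 ("`V̄_j` is continuously differentiable in the
initial condition `ḡ₀`").

## What this file proves (explicit constants; `C_{2,0} = (1+N)/c + N + 2Ω/(Ω-1)`)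

Under `CutoffQuadHyp P Ω k B c N C lam b` at a top initial condition `b` and the smallness
`8B²C_{2,0}b ≤ 1` of `gbarDeriv_pos` (so `ḡ_j' ≥ 0`):
* `gbar_mono_init` (`ḡ_j` is non-decreasing in `g₀ ∈ (0,b]`), `abs_gbarDeriv_le` (`|ḡ_j'| ≤ (ḡ_j/g₀)²`);
* `QuadFlowParams.zetaLogDeriv`, `zetaInvProdDeriv`, `hasDerivAt_zetaInvProd` and
  `abs_zetaInvProdDeriv_le` — `(Π^ζ_{j,l})' = Π^ζ_{j,l}Σ_i ζ_iḡ_i'(1 - ζ_iḡ_i)⁻¹ = O(χ_jḡ_j/ḡ₀²)`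
  (`≤ 4C·C_{2,0}χ_jḡ_j/g₀²`);
* `QuadFlowParams.zbarDeriv`, **`hasDerivAt_zbar`** (termwise differentiation of (2.14), justified by
  `hasDerivAt_tsum_of_isPreconnected` with `g₀`-uniform majorants on `(g₀/2, b)`) and
  **`abs_zbarDeriv_le`**: `|z̄_j'| ≤ K_zχ_jḡ_j²/g₀²`, `K_z = 4C²C_{2,0}² + 8C·C_{2,0}`;
* `QuadFlowParams.tauDeriv`, `sigmaDeriv`, `lamLogDeriv`, `lamInvProdDeriv`, `mubarDeriv` with
  `hasDerivAt_tau`, `hasDerivAt_sigma`, `hasDerivAt_lamInvProd`, **`hasDerivAt_mubar`** and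
  **`abs_mubarDeriv_le`**: `|μ̄_j'| ≤ K_μχ_jḡ_j²/g₀²`;
* **`hasDerivAt_flow`**: every component of `V̄_j` is differentiable in `g₀ ∈ (0,b)` with the bound
  (2.33), `|V̄_j'| ≤ Kχ_jḡ_j²/g₀²`.

Deliberately NOT here: the second derivatives `V̄_j''` ((2.34)) and the continuity of `V̄_j'`.
-/

noncomputable section

open Filter Topology Set Finset
open scoped BigOperators

namespace Literature.Barriers.CriticalPhenomena

namespace CTWSAW

/-! ### `ḡ_j` is non-decreasing in `g₀`; `|ḡ_j'| ≤ (ḡ_j/g₀)²` -/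

namespace CutoffGbarHyp

variable {β : ℕ → ℝ} {Ω : ℝ} {k : ℕ∞} {B c : ℝ} {N : ℕ} {b : ℝ} (h : CutoffGbarHyp β Ω k B c N b)
include h

/-- `|ḡ_j'| ≤ (ḡ_j/g₀)²` (`ḡ_j' ∈ [0, (ḡ_j/g₀)²]` under `8B²C_{2,0}g₀ ≤ 1`).
[cite: BauerschmidtBrydgesSlade2015Flow, Lemma 2.3, (2.33) and (2.36)] -/
theorem abs_gbarDeriv_le (hsmall : 8 * B ^ 2 * ((1 + N) / c + N + 2 * Ω / (Ω - 1)) * b ≤ 1) (j : ℕ) :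
    |gbarDeriv β b j| ≤ (gbar β b j / b) ^ 2 := by
  rw [abs_of_pos (h.gbarDeriv_pos hsmall j)]
  exact (h.gbarDeriv_mem j).2

/-- **`ḡ_j` is non-decreasing in the initial condition** on `(0, b]` (its derivative
`∏(1 - 2β_lḡ_l)` is positive there). [cite: BauerschmidtBrydgesSlade2015Flow, Lemma 2.1(i) ("ḡ_j is non-increasing in β_k") and Lemma 2.3 (ḡ_j' = (ḡ_j/ḡ₀)²(1+O(ḡ₀)) > 0)] -/
theorem gbar_mono_init (hsmall : 8 * B ^ 2 * ((1 + N) / c + N + 2 * Ω / (Ω - 1)) * b ≤ 1) (j : ℕ)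
    {g g' : ℝ} (hg : 0 < g) (hgg' : g ≤ g') (hg'b : g' ≤ b) : gbar β g j ≤ gbar β g' j := by
  have hmono : MonotoneOn (fun x => gbar β x j) (Icc g g') := by
    refine monotoneOn_of_deriv_nonneg (convex_Icc g g') (continuous_gbar β j).continuousOn
      (fun x _ => (hasDerivAt_gbar β j x).differentiableAt.differentiableWithinAt) fun x hx => ?_
    rw [interior_Icc] at hx
    rw [(hasDerivAt_gbar β j x).deriv]
    have hx0 : 0 < x := hg.trans hx.1
    have hxb : x ≤ b := hx.2.le.trans hg'b
    have hsx : 8 * B ^ 2 * ((1 + N) / c + N + 2 * Ω / (Ω - 1)) * x ≤ 1 := by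
      refine le_trans ?_ hsmall
      have : 0 ≤ 8 * B ^ 2 * ((1 + N) / c + N + 2 * Ω / (Ω - 1)) :=
        mul_nonneg (by positivity) h.C20_nonneg
      exact mul_le_mul_of_nonneg_left hxb this
    exact ((h.mono hx0 hxb).gbarDeriv_pos hsx j).le
  exact hmono ⟨le_rfl, hgg'⟩ ⟨hgg', le_rfl⟩ hgg'

end CutoffGbarHyp

/-! ### `(Π^ζ_{j,l})'` -/

namespace QuadFlowParams

variable (P : QuadFlowParams) (g₀ : ℝ)

/-- The logarithmic derivative of `Π^ζ_{j,l}` in `g₀`: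
`Σ_{i=0}^{l} ζ_{i+j}ḡ_{i+j}'(1 - ζ_{i+j}ḡ_{i+j})⁻¹`.
[cite: BauerschmidtBrydgesSlade2015Flow, Lemma 2.3 (proof: σ_{j,l}' = σ_{j,l}Σ_{k=j}^l(1-ζ_kḡ_k)⁻¹ζ_kḡ_k')] -/
def zetaLogDeriv (j l : ℕ) : ℝ :=
  ∑ i ∈ Finset.range (l + 1),
    P.ζ (i + j) * gbarDeriv P.β g₀ (i + j) * (1 - P.ζ (i + j) * gbar P.β g₀ (i + j))⁻¹

/-- `(Π^ζ_{j,l})' = Π^ζ_{j,l} · Σ_{i}ζ_iḡ_i'(1 - ζ_iḡ_i)⁻¹`. [cite: BauerschmidtBrydgesSlade2015Flow, Lemma 2.3 (proof, σ_{j,l}')] -/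
def zetaInvProdDeriv (j l : ℕ) : ℝ := P.zetaInvProd g₀ j l * P.zetaLogDeriv g₀ j l

/-- The `l`-th term of the series for `z̄_j'`:
`(Π^ζ_{j,l})'θ_{l+j}ḡ_{l+j}² + Π^ζ_{j,l}θ_{l+j}·2ḡ_{l+j}ḡ_{l+j}'`.
[cite: BauerschmidtBrydgesSlade2015Flow, Lemma 2.3, (zbarprime)] -/
def zbarDerivTerm (j l : ℕ) : ℝ :=
  P.zetaInvProdDeriv g₀ j l * (P.θ (l + j) * gbar P.β g₀ (l + j) ^ 2) +
    P.zetaInvProd g₀ j l * (P.θ (l + j) * (2 * gbar P.β g₀ (l + j) * gbarDeriv P.β g₀ (l + j)))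

/-- **`z̄_j' = Σ_l(Π^ζ_{j,l})'θ_lḡ_l² + 2Σ_lΠ^ζ_{j,l}θ_lḡ_lḡ_l'`** (the derivative of (2.14) in `g₀`).
[cite: BauerschmidtBrydgesSlade2015Flow, Lemma 2.3, (zbarprime)] -/
def zbarDeriv (j : ℕ) : ℝ := ∑' l, P.zbarDerivTerm g₀ j l

/-- `Σ^ζ_{j,0} = ζ_jḡ_j'(1 - ζ_jḡ_j)⁻¹`. [cite: BauerschmidtBrydgesSlade2015Flow, Lemma 2.3 (proof)] -/
theorem zetaLogDeriv_zero (j : ℕ) :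
    P.zetaLogDeriv g₀ j 0 = P.ζ j * gbarDeriv P.β g₀ j * (1 - P.ζ j * gbar P.β g₀ j)⁻¹ := by
  simp [zetaLogDeriv]

/-- `Σ^ζ_{j,l+1} = ζ_jḡ_j'(1 - ζ_jḡ_j)⁻¹ + Σ^ζ_{j+1,l}`. [cite: BauerschmidtBrydgesSlade2015Flow, Lemma 2.3 (proof)] -/
theorem zetaLogDeriv_succ (j l : ℕ) :
    P.zetaLogDeriv g₀ j (l + 1) =
      P.ζ j * gbarDeriv P.β g₀ j * (1 - P.ζ j * gbar P.β g₀ j)⁻¹ + P.zetaLogDeriv g₀ (j + 1) l := by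
  unfold zetaLogDeriv
  rw [Finset.sum_range_succ' _ (l + 1), zero_add, add_comm]
  congr 1
  exact Finset.sum_congr rfl fun i _ => by rw [Nat.add_right_comm, Nat.add_assoc]

end QuadFlowParams

/-- The derivative of a factor `(1 - ζ_nḡ_n)⁻¹` in `g₀`: `ζ_nḡ_n'(1 - ζ_nḡ_n)⁻²`.
[cite: BauerschmidtBrydgesSlade2015Flow, Lemma 2.3 (proof, σ_{j,l}')] -/
theorem hasDerivAt_inv_one_sub_zeta_mul_gbar (P : QuadFlowParams) (n : ℕ) (g : ℝ)
    (hne : 1 - P.ζ n * gbar P.β g n ≠ 0) :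
    HasDerivAt (fun x => (1 - P.ζ n * gbar P.β x n)⁻¹)
      (P.ζ n * gbarDeriv P.β g n * (1 - P.ζ n * gbar P.β g n)⁻¹ ^ 2) g := by
  have h1 : HasDerivAt (fun x => 1 - P.ζ n * gbar P.β x n) (-(P.ζ n * gbarDeriv P.β g n)) g :=
    ((hasDerivAt_gbar P.β n g).const_mul (P.ζ n)).const_sub 1
  have h2 : HasDerivAt (fun x => (1 - P.ζ n * gbar P.β x n)⁻¹)
      (-(-(P.ζ n * gbarDeriv P.β g n)) / (1 - P.ζ n * gbar P.β g n) ^ 2) g := HasDerivAt.inv h1 hne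
  refine h2.congr_deriv ?_
  rw [neg_neg, inv_pow, div_eq_mul_inv]

/-- **`Π^ζ_{j,l}` is differentiable in `g₀`** with derivative `Π^ζ_{j,l}Σ^ζ_{j,l}` (all factors being
nonzero). [cite: BauerschmidtBrydgesSlade2015Flow, Lemma 2.3 (proof: σ_{j,l}' = σ_{j,l}Σ_k(1-ζ_kḡ_k)⁻¹ζ_kḡ_k')] -/
theorem hasDerivAt_zetaInvProd (P : QuadFlowParams) {g : ℝ} (hne : ∀ n, 1 - P.ζ n * gbar P.β g n ≠ 0)
    (j l : ℕ) : HasDerivAt (fun x => P.zetaInvProd x j l) (P.zetaInvProdDeriv g j l) g := by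
  induction l generalizing j with
  | zero =>
    have e : (fun x => P.zetaInvProd x j 0) = fun x => (1 - P.ζ j * gbar P.β x j)⁻¹ :=
      funext fun x => P.zetaInvProd_zero x j
    rw [e]
    refine (hasDerivAt_inv_one_sub_zeta_mul_gbar P j g (hne j)).congr_deriv ?_
    simp only [QuadFlowParams.zetaInvProdDeriv, QuadFlowParams.zetaLogDeriv_zero,
      QuadFlowParams.zetaInvProd_zero]
    ring
  | succ l ih =>
    have e : (fun x => P.zetaInvProd x j (l + 1)) =
        fun x => (1 - P.ζ j * gbar P.β x j)⁻¹ * P.zetaInvProd x (j + 1) l :=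
      funext fun x => P.zetaInvProd_succ x j l
    rw [e]
    refine ((hasDerivAt_inv_one_sub_zeta_mul_gbar P j g (hne j)).mul (ih (j + 1))).congr_deriv ?_
    simp only [QuadFlowParams.zetaInvProdDeriv, QuadFlowParams.zetaLogDeriv_succ,
      QuadFlowParams.zetaInvProd_succ]
    ring

/-- A sum over `range (l+1)` of the shifted sequence is a sum over the scales `[j, j+l]`. [folklore] -/
theorem sum_range_shift_eq_sum_Icc (f : ℕ → ℝ) (j l : ℕ) :
    ∑ i ∈ Finset.range (l + 1), f (i + j) = ∑ m ∈ Finset.Icc j (j + l), f m := by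
  rw [Finset.range_eq_Ico, Finset.sum_Ico_add' f, zero_add, show l + 1 + j = j + l + 1 by ring,
    Finset.Ico_add_one_right_eq_Icc]


/-- `|a| ≤ A`, `|b| ≤ B` ⟹ `|a + b| ≤ A + B`. [folklore] -/
theorem abs_add_le_of_le' {a b A B : ℝ} (ha : |a| ≤ A) (hb : |b| ≤ B) : |a + b| ≤ A + B :=
  (abs_add_le a b).trans (add_le_add ha hb)

/-- `|a| ≤ A`, `|b| ≤ B` ⟹ `|a - b| ≤ A + B`. [folklore] -/
theorem abs_sub_le_of_le' {a b A B : ℝ} (ha : |a| ≤ A) (hb : |b| ≤ B) : |a - b| ≤ A + B :=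
  (abs_sub a b).trans (add_le_add ha hb)

/-! ### Bounds under `CutoffQuadHyp` -/

namespace CutoffQuadHyp

variable {P : QuadFlowParams} {Ω : ℝ} {k : ℕ∞} {B c : ℝ} {N : ℕ} {C lam g₀ : ℝ}
  (h : CutoffQuadHyp P Ω k B c N C lam g₀)
include h

/-- The factors `1 - ζ_nḡ_n` are nonzero (they lie in `[1/2, 3/2]`). [cite: BauerschmidtBrydgesSlade2015Flow, Lemma 2.1(iii)(b)] -/
theorem one_sub_zeta_mul_gbar_ne_zero (n : ℕ) : 1 - P.ζ n * gbar P.β g₀ n ≠ 0 := by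
  have := (h.toCutoffGbarHyp.one_sub_zeta_mul_gbar_mem h.zeta_le h.smallC1 n).1
  intro h0; rw [h0] at this; norm_num at this

/-- `0 ≤ (1 - ζ_nḡ_n)⁻¹ ≤ 2`. [cite: BauerschmidtBrydgesSlade2015Flow, Lemma 2.1(iii)(b)] -/
theorem inv_one_sub_zeta_mul_gbar_mem (n : ℕ) : (1 - P.ζ n * gbar P.β g₀ n)⁻¹ ∈ Set.Icc (0 : ℝ) 2 := by
  obtain ⟨h1, -⟩ := h.toCutoffGbarHyp.one_sub_zeta_mul_gbar_mem h.zeta_le h.smallC1 n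
  have hpos : 0 < 1 - P.ζ n * gbar P.β g₀ n := by linarith
  refine ⟨inv_nonneg.2 hpos.le, ?_⟩
  rw [inv_le_comm₀ hpos (by norm_num)]
  linarith

/-- **`|Σ^ζ_{j,l}| ≤ 2C·C_{2,0}χ_jḡ_j/g₀²`** (`Σ_kO(ζ_kḡ_k') = O(χ_jḡ_j/ḡ₀²)`, uniformly in `l`).
[cite: BauerschmidtBrydgesSlade2015Flow, Lemma 2.3 (proof: σ_{j,l}' = Σ_{k=j}^lO(ζ_kḡ_k') = O(χ_jḡ_j/ḡ₀²))] -/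
theorem abs_zetaLogDeriv_le (hsmall : 8 * B ^ 2 * ((1 + N) / c + N + 2 * Ω / (Ω - 1)) * g₀ ≤ 1)
    (j l : ℕ) : |P.zetaLogDeriv g₀ j l| ≤
      2 * C * ((1 + N) / c + N + 2 * Ω / (Ω - 1)) * (cutoffWeight Ω k j * gbar P.β g₀ j) / g₀ ^ 2 := by
  have hG := h.toCutoffGbarHyp
  have hg := hG.g₀_pos
  have hC := h.C_nonneg
  unfold QuadFlowParams.zetaLogDeriv
  have hterm : ∀ i, |P.ζ (i + j) * gbarDeriv P.β g₀ (i + j) * (1 - P.ζ (i + j) * gbar P.β g₀ (i + j))⁻¹|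
      ≤ 2 * C / g₀ ^ 2 * (cutoffWeight Ω k (i + j) * gbar P.β g₀ (i + j) ^ 2) := fun i => by
    have hz := h.zeta_le (i + j)
    have hd := hG.abs_gbarDeriv_le hsmall (i + j)
    have hw := (hG.weight_pos (i + j)).le
    obtain ⟨hf0, hf2⟩ := h.inv_one_sub_zeta_mul_gbar_mem (i + j)
    rw [abs_mul, abs_mul, abs_of_nonneg hf0]
    calc |P.ζ (i + j)| * |gbarDeriv P.β g₀ (i + j)| * (1 - P.ζ (i + j) * gbar P.β g₀ (i + j))⁻¹
        ≤ (C * cutoffWeight Ω k (i + j)) * (gbar P.β g₀ (i + j) / g₀) ^ 2 * 2 :=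
          mul_le_mul (mul_le_mul hz hd (abs_nonneg _) (mul_nonneg hC hw)) hf2 hf0
            (mul_nonneg (mul_nonneg hC hw) (sq_nonneg _))
      _ = 2 * C / g₀ ^ 2 * (cutoffWeight Ω k (i + j) * gbar P.β g₀ (i + j) ^ 2) := by
          field_simp
  calc |∑ i ∈ Finset.range (l + 1),
        P.ζ (i + j) * gbarDeriv P.β g₀ (i + j) * (1 - P.ζ (i + j) * gbar P.β g₀ (i + j))⁻¹|
      ≤ ∑ i ∈ Finset.range (l + 1),
          |P.ζ (i + j) * gbarDeriv P.β g₀ (i + j) * (1 - P.ζ (i + j) * gbar P.β g₀ (i + j))⁻¹| :=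
        Finset.abs_sum_le_sum_abs _ _
    _ ≤ ∑ i ∈ Finset.range (l + 1), 2 * C / g₀ ^ 2 * (cutoffWeight Ω k (i + j) * gbar P.β g₀ (i + j) ^ 2) :=
        Finset.sum_le_sum fun i _ => hterm i
    _ = 2 * C / g₀ ^ 2 * ∑ m ∈ Finset.Icc j (j + l), cutoffWeight Ω k m * gbar P.β g₀ m ^ 2 := by
        rw [← Finset.mul_sum, sum_range_shift_eq_sum_Icc (fun m => cutoffWeight Ω k m * gbar P.β g₀ m ^ 2)]
    _ ≤ 2 * C / g₀ ^ 2 * (((1 + N) / c + N + 2 * Ω / (Ω - 1)) * (cutoffWeight Ω k j * gbar P.β g₀ j)) :=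
        mul_le_mul_of_nonneg_left (hG.sum_weight_mul_gbar_sq_le j (j + l)) (by positivity)
    _ = _ := by field_simp

/-- **`|(Π^ζ_{j,l})'| ≤ 4C·C_{2,0}χ_jḡ_j/g₀²`** ("`σ_{j,l}' = O(χ_jḡ_j/ḡ₀²)`").
[cite: BauerschmidtBrydgesSlade2015Flow, Lemma 2.3 (proof, σ_{j,l}' = O(χ_jḡ_j/ḡ₀²))] -/
theorem abs_zetaInvProdDeriv_le (hsmall : 8 * B ^ 2 * ((1 + N) / c + N + 2 * Ω / (Ω - 1)) * g₀ ≤ 1)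
    (j l : ℕ) : |P.zetaInvProdDeriv g₀ j l| ≤
      4 * C * ((1 + N) / c + N + 2 * Ω / (Ω - 1)) * (cutoffWeight Ω k j * gbar P.β g₀ j) / g₀ ^ 2 := by
  obtain ⟨h0, h2⟩ := h.zetaInvProd_mem j l
  have hS := h.abs_zetaLogDeriv_le hsmall j l
  have hg := h.toCutoffGbarHyp.g₀_pos
  have hnn : 0 ≤ 2 * C * ((1 + N) / c + N + 2 * Ω / (Ω - 1)) * (cutoffWeight Ω k j * gbar P.β g₀ j) / g₀ ^ 2 :=
    (abs_nonneg _).trans hS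
  unfold QuadFlowParams.zetaInvProdDeriv
  rw [abs_mul, abs_of_nonneg h0]
  calc P.zetaInvProd g₀ j l * |P.zetaLogDeriv g₀ j l|
      ≤ 2 * (2 * C * ((1 + N) / c + N + 2 * Ω / (Ω - 1)) * (cutoffWeight Ω k j * gbar P.β g₀ j) / g₀ ^ 2) :=
        mul_le_mul h2 hS (abs_nonneg _) zero_le_two
    _ = _ := by ring

/-- **Termwise bound for `z̄_j'`**: `|(Π^ζ)'θḡ² + Π^ζθ·2ḡḡ'| ≤
(4C²C_{2,0}χ_jḡ_j·χ_{l+j}ḡ_{l+j}² + 4Cχ_{l+j}ḡ_{l+j}³)/g₀²`.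
[cite: BauerschmidtBrydgesSlade2015Flow, Lemma 2.3, (zbarprime)] -/
theorem abs_zbarDerivTerm_le (hsmall : 8 * B ^ 2 * ((1 + N) / c + N + 2 * Ω / (Ω - 1)) * g₀ ≤ 1)
    (j l : ℕ) : |P.zbarDerivTerm g₀ j l| ≤
      (4 * C ^ 2 * ((1 + N) / c + N + 2 * Ω / (Ω - 1)) * (cutoffWeight Ω k j * gbar P.β g₀ j) *
          (cutoffWeight Ω k (l + j) * gbar P.β g₀ (l + j) ^ 2) +
        4 * C * (cutoffWeight Ω k (l + j) * gbar P.β g₀ (l + j) ^ 3)) / g₀ ^ 2 := by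
  have hG := h.toCutoffGbarHyp
  have hg := hG.g₀_pos
  have hC := h.C_nonneg
  have hZ' := h.abs_zetaInvProdDeriv_le hsmall j l
  obtain ⟨hP0, hP2⟩ := h.zetaInvProd_mem j l
  have hθ := h.theta_le (l + j)
  have hd := hG.abs_gbarDeriv_le hsmall (l + j)
  have hgl := (hG.gbar_pos (l + j)).le
  have hw := (hG.weight_pos (l + j)).le
  unfold QuadFlowParams.zbarDerivTerm
  refine (abs_add_le _ _).trans ?_
  have hwj := (hG.weight_pos j).le
  have hgj := (hG.gbar_pos j).le
  have h1 : |P.zetaInvProdDeriv g₀ j l * (P.θ (l + j) * gbar P.β g₀ (l + j) ^ 2)| ≤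
      (4 * C * ((1 + N) / c + N + 2 * Ω / (Ω - 1)) * (cutoffWeight Ω k j * gbar P.β g₀ j) / g₀ ^ 2) *
        ((C * cutoffWeight Ω k (l + j)) * gbar P.β g₀ (l + j) ^ 2) := by
    rw [abs_mul, abs_mul, abs_of_nonneg (sq_nonneg (gbar P.β g₀ (l + j)))]
    exact mul_le_mul hZ' (mul_le_mul_of_nonneg_right hθ (sq_nonneg _)) (by positivity)
      ((abs_nonneg _).trans hZ')
  have h2 : |P.zetaInvProd g₀ j l * (P.θ (l + j) * (2 * gbar P.β g₀ (l + j) * gbarDeriv P.β g₀ (l + j)))| ≤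
      2 * ((C * cutoffWeight Ω k (l + j)) * (2 * gbar P.β g₀ (l + j) * (gbar P.β g₀ (l + j) / g₀) ^ 2)) := by
    rw [abs_mul, abs_of_nonneg hP0, abs_mul, abs_mul,
      abs_of_nonneg (by positivity : (0 : ℝ) ≤ 2 * gbar P.β g₀ (l + j))]
    exact mul_le_mul hP2 (mul_le_mul hθ (mul_le_mul_of_nonneg_left hd (by positivity)) (by positivity)
      (by positivity)) (by positivity) zero_le_two
  refine (add_le_add h1 h2).trans (le_of_eq ?_)
  field_simp
  ring

end CutoffQuadHyp

/-! ### `z̄_j` is differentiable in `g₀`, `|z̄_j'| ≤ K_zχ_jḡ_j²/g₀²` -/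

section Zbar

variable {P : QuadFlowParams} {Ω : ℝ} {k : ℕ∞} {B c : ℝ} {N : ℕ} {C lam b : ℝ}

/-- The `l`-th term of (2.14) is differentiable in `g₀` with derivative `zbarDerivTerm`.
[cite: BauerschmidtBrydgesSlade2015Flow, Lemma 2.3, (zbarprime)] -/
theorem hasDerivAt_zbarTerm (P : QuadFlowParams) {g : ℝ} (hne : ∀ n, 1 - P.ζ n * gbar P.β g n ≠ 0)
    (j l : ℕ) : HasDerivAt (fun x => P.zetaInvProd x j l * (P.θ (l + j) * gbar P.β x (l + j) ^ 2))
      (P.zbarDerivTerm g j l) g := by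
  have h1 := hasDerivAt_zetaInvProd P hne j l
  have h2 : HasDerivAt (fun x => P.θ (l + j) * gbar P.β x (l + j) ^ 2)
      (P.θ (l + j) * (2 * gbar P.β g (l + j) * gbarDeriv P.β g (l + j))) g := by
    refine (((hasDerivAt_gbar P.β (l + j) g).fun_pow 2).const_mul (P.θ (l + j))).congr_deriv ?_
    norm_num
  exact h1.mul h2

/-- The numerator of the termwise majorant, monotone in the data. [folklore] -/
theorem zbarMajorant_mono {C C20 wj wl gj gl gj' gl' : ℝ} (hC : 0 ≤ C) (hC20 : 0 ≤ C20) (hwj : 0 ≤ wj)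
    (hwl : 0 ≤ wl) (hgj : 0 ≤ gj) (hgl : 0 ≤ gl) (hj : gj ≤ gj') (hl : gl ≤ gl') :
    4 * C ^ 2 * C20 * (wj * gj) * (wl * gl ^ 2) + 4 * C * (wl * gl ^ 3) ≤
      4 * C ^ 2 * C20 * (wj * gj') * (wl * gl' ^ 2) + 4 * C * (wl * gl' ^ 3) := by
  have hgj' : 0 ≤ gj' := hgj.trans hj
  have hgl' : 0 ≤ gl' := hgl.trans hl
  gcongr

/-- **[BBS-rg-flow, Lemma 2.3] for `z̄`: `z̄_j` is differentiable in the initial condition**, with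
derivative `zbarDeriv` (termwise differentiation of (2.14)), for `g₀ ∈ (0, b)` when the hypotheses
hold at `b` with `8B²C_{2,0}b ≤ 1`.
[cite: BauerschmidtBrydgesSlade2015Flow, Lemma 2.3 ("It is straightforward to justify the differentiation under the sum in (zbarprime)")] -/
theorem hasDerivAt_zbar (hb : CutoffQuadHyp P Ω k B c N C lam b)
    (hsmall : 8 * B ^ 2 * ((1 + N) / c + N + 2 * Ω / (Ω - 1)) * b ≤ 1) {g : ℝ} (hg : 0 < g)
    (hgb : g < b) (j : ℕ) : HasDerivAt (fun x => P.zbar x j) (P.zbarDeriv g j) g := by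
  have hGb := hb.toCutoffGbarHyp
  have hC := hb.C_nonneg
  have hC20 := hGb.C20_nonneg
  -- the open interval `t = (g/2, b)` and the hypotheses along it
  have ha0 : 0 < g / 2 := by positivity
  have hsm : ∀ x : ℝ, x ≤ b → 8 * B ^ 2 * ((1 + N) / c + N + 2 * Ω / (Ω - 1)) * x ≤ 1 := fun x hx =>
    le_trans (mul_le_mul_of_nonneg_left hx (mul_nonneg (by positivity) hC20)) hsmall
  have hyp : ∀ x ∈ Ioo (g / 2) b, CutoffQuadHyp P Ω k B c N C lam x := fun x hx =>
    hb.mono (ha0.trans hx.1) hx.2.le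
  have hmono : ∀ x ∈ Ioo (g / 2) b, ∀ n, gbar P.β x n ≤ gbar P.β b n := fun x hx n =>
    hGb.gbar_mono_init hsmall n (ha0.trans hx.1) hx.2.le le_rfl
  -- `g₀`-uniform majorant on `t`: `ḡ_n(x) ≤ ḡ_n(b)`, `x ≥ g/2`
  obtain ⟨hs2, -⟩ := hGb.summable_weight_mul_gbar_sq j
  obtain ⟨hs3, -⟩ := hGb.tsum_weight_mul_gbar_cube_le j
  set A : ℝ := 4 * C ^ 2 * ((1 + N) / c + N + 2 * Ω / (Ω - 1)) * (cutoffWeight Ω k j * gbar P.β b j) /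
    (g / 2) ^ 2 with hA
  set A' : ℝ := 4 * C / (g / 2) ^ 2 with hA'
  have hu_sum : Summable fun l => A * (cutoffWeight Ω k (l + j) * gbar P.β b (l + j) ^ 2) +
      A' * (cutoffWeight Ω k (l + j) * gbar P.β b (l + j) ^ 3) :=
    (hs2.mul_left A).add (hs3.mul_left A')
  refine hasDerivAt_tsum_of_isPreconnected (t := Ioo (g / 2) b) (y₀ := g) hu_sum isOpen_Ioo
    isPreconnected_Ioo (fun l x hx => hasDerivAt_zbarTerm P (hyp x hx).one_sub_zeta_mul_gbar_ne_zero j l)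
    (fun l x hx => ?_) ⟨by linarith, hgb⟩ ((hb.mono hg hgb.le).summable_zbar_term j) ⟨by linarith, hgb⟩
  -- the termwise bound at `x`, then monotonicity in `x`
  have hx0 : 0 < x := ha0.trans hx.1
  have hGx := (hyp x hx).toCutoffGbarHyp
  have hwj := (hGx.weight_pos j).le
  have hwl := (hGx.weight_pos (l + j)).le
  have hgj := (hGx.gbar_pos j).le
  have hgl := (hGx.gbar_pos (l + j)).le
  have hnum := zbarMajorant_mono (C := C) (C20 := (1 + N) / c + N + 2 * Ω / (Ω - 1)) hC hC20 hwj hwl hgj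
    hgl (hmono x hx j) (hmono x hx (l + j))
  have hnn : 0 ≤ 4 * C ^ 2 * ((1 + N) / c + N + 2 * Ω / (Ω - 1)) * (cutoffWeight Ω k j * gbar P.β b j) *
        (cutoffWeight Ω k (l + j) * gbar P.β b (l + j) ^ 2) +
      4 * C * (cutoffWeight Ω k (l + j) * gbar P.β b (l + j) ^ 3) := le_trans (by positivity) hnum
  have hx2 : (g / 2) ^ 2 ≤ x ^ 2 := pow_le_pow_left₀ ha0.le hx.1.le 2
  rw [Real.norm_eq_abs]
  calc |P.zbarDerivTerm x j l|
      ≤ (4 * C ^ 2 * ((1 + N) / c + N + 2 * Ω / (Ω - 1)) * (cutoffWeight Ω k j * gbar P.β x j) *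
            (cutoffWeight Ω k (l + j) * gbar P.β x (l + j) ^ 2) +
          4 * C * (cutoffWeight Ω k (l + j) * gbar P.β x (l + j) ^ 3)) / x ^ 2 :=
        (hyp x hx).abs_zbarDerivTerm_le (hsm x hx.2.le) j l
    _ ≤ (4 * C ^ 2 * ((1 + N) / c + N + 2 * Ω / (Ω - 1)) * (cutoffWeight Ω k j * gbar P.β b j) *
            (cutoffWeight Ω k (l + j) * gbar P.β b (l + j) ^ 2) +
          4 * C * (cutoffWeight Ω k (l + j) * gbar P.β b (l + j) ^ 3)) / x ^ 2 :=
        div_le_div_of_nonneg_right hnum (by positivity)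
    _ ≤ (4 * C ^ 2 * ((1 + N) / c + N + 2 * Ω / (Ω - 1)) * (cutoffWeight Ω k j * gbar P.β b j) *
            (cutoffWeight Ω k (l + j) * gbar P.β b (l + j) ^ 2) +
          4 * C * (cutoffWeight Ω k (l + j) * gbar P.β b (l + j) ^ 3)) / (g / 2) ^ 2 :=
        div_le_div_of_nonneg_left hnn (by positivity) hx2
    _ = A * (cutoffWeight Ω k (l + j) * gbar P.β b (l + j) ^ 2) +
          A' * (cutoffWeight Ω k (l + j) * gbar P.β b (l + j) ^ 3) := by
        rw [hA, hA']
        ring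

/-- **[BBS-rg-flow, Lemma 2.3, (2.33) for `z̄`]: `|z̄_j'| ≤ K_zχ_jḡ_j²/g₀²`**,
`K_z = 4C²C_{2,0}² + 8C·C_{2,0}` ("`z̄_j' = O(χ_jḡ_j²/ḡ₀²)`").
[cite: BauerschmidtBrydgesSlade2015Flow, Lemma 2.3, (2.33) and (zbarprime)] -/
theorem CutoffQuadHyp.abs_zbarDeriv_le {g₀ : ℝ} (h : CutoffQuadHyp P Ω k B c N C lam g₀)
    (hsmall : 8 * B ^ 2 * ((1 + N) / c + N + 2 * Ω / (Ω - 1)) * g₀ ≤ 1) (j : ℕ) :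
    |P.zbarDeriv g₀ j| ≤
      (4 * C ^ 2 * ((1 + N) / c + N + 2 * Ω / (Ω - 1)) ^ 2 + 8 * C * ((1 + N) / c + N + 2 * Ω / (Ω - 1))) *
        (cutoffWeight Ω k j * gbar P.β g₀ j ^ 2) / g₀ ^ 2 := by
  have hG := h.toCutoffGbarHyp
  have hg := hG.g₀_pos
  have hC := h.C_nonneg
  have hC20 := hG.C20_nonneg
  obtain ⟨hs2, ht2⟩ := hG.summable_weight_mul_gbar_sq j
  obtain ⟨hs3, ht3⟩ := hG.tsum_weight_mul_gbar_cube_le j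
  have hwj := (hG.weight_pos j).le
  have hwj1 := hG.weight_le_one j
  have hgj := (hG.gbar_pos j).le
  set A : ℝ := 4 * C ^ 2 * ((1 + N) / c + N + 2 * Ω / (Ω - 1)) * (cutoffWeight Ω k j * gbar P.β g₀ j) /
    g₀ ^ 2 with hA
  set A' : ℝ := 4 * C / g₀ ^ 2 with hA'
  have hA0 : 0 ≤ A := by positivity
  have hA'0 : 0 ≤ A' := by positivity
  set v : ℕ → ℝ := fun l => A * (cutoffWeight Ω k (l + j) * gbar P.β g₀ (l + j) ^ 2) +
    A' * (cutoffWeight Ω k (l + j) * gbar P.β g₀ (l + j) ^ 3) with hv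
  have hv_sum : Summable v := (hs2.mul_left A).add (hs3.mul_left A')
  have hle : ∀ l, |P.zbarDerivTerm g₀ j l| ≤ v l := fun l => by
    refine (h.abs_zbarDerivTerm_le hsmall j l).trans (le_of_eq ?_)
    rw [hv, hA, hA']
    ring
  have hsum : Summable fun l => P.zbarDerivTerm g₀ j l :=
    Summable.of_norm_bounded hv_sum fun l => by rw [Real.norm_eq_abs]; exact hle l
  calc |P.zbarDeriv g₀ j| ≤ ∑' l, |P.zbarDerivTerm g₀ j l| := by
        have := norm_tsum_le_tsum_norm (f := fun l => P.zbarDerivTerm g₀ j l)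
          (by simpa only [Real.norm_eq_abs] using hsum.abs)
        simpa only [QuadFlowParams.zbarDeriv, Real.norm_eq_abs] using this
    _ ≤ ∑' l, v l := Summable.tsum_le_tsum hle hsum.abs hv_sum
    _ = A * ∑' l, cutoffWeight Ω k (l + j) * gbar P.β g₀ (l + j) ^ 2 +
          A' * ∑' l, cutoffWeight Ω k (l + j) * gbar P.β g₀ (l + j) ^ 3 := by
        rw [hv, (hs2.mul_left A).tsum_add (hs3.mul_left A'), tsum_mul_left, tsum_mul_left]
    _ ≤ A * (((1 + N) / c + N + 2 * Ω / (Ω - 1)) * (cutoffWeight Ω k j * gbar P.β g₀ j)) +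
          A' * (2 * ((1 + N) / c + N + 2 * Ω / (Ω - 1)) * (cutoffWeight Ω k j * gbar P.β g₀ j ^ 2)) :=
        add_le_add (mul_le_mul_of_nonneg_left ht2 hA0) (mul_le_mul_of_nonneg_left ht3 hA'0)
    _ = (4 * C ^ 2 * ((1 + N) / c + N + 2 * Ω / (Ω - 1)) ^ 2 * cutoffWeight Ω k j +
          8 * C * ((1 + N) / c + N + 2 * Ω / (Ω - 1))) *
          (cutoffWeight Ω k j * gbar P.β g₀ j ^ 2) / g₀ ^ 2 := by
        rw [hA, hA']
        field_simp
        ring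
    _ ≤ _ := by
        refine div_le_div_of_nonneg_right (mul_le_mul_of_nonneg_right ?_ (by positivity)) (by positivity)
        nlinarith [mul_nonneg (by positivity : (0 : ℝ) ≤ 4 * C ^ 2 *
          ((1 + N) / c + N + 2 * Ω / (Ω - 1)) ^ 2) (sub_nonneg.2 hwj1)]

end Zbar

/-! ### Constants -/

/-- `K_z = 4C²C_{2,0}² + 8C·C_{2,0}`, the constant of `|z̄_j'| ≤ K_zχ_jḡ_j²/g₀²`. [cite: BauerschmidtBrydgesSlade2015Flow, Lemma 2.3, (2.33)] -/
def zDerivConst (C c20 : ℝ) : ℝ := 4 * C ^ 2 * c20 ^ 2 + 8 * C * c20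

/-- `K_σ = C(3 + 3Z + Z²)/2`, `Z = 2C·C_{2,0}`, the constant of `|σ_l| ≤ K_σχ_lḡ_l` (Lemma 2.2). [cite: BauerschmidtBrydgesSlade2015Flow, Lemma 2.2, (2.16)] -/
def sigmaConst (C c20 : ℝ) : ℝ := C * (3 + 3 * (2 * C * c20) + (2 * C * c20) ^ 2) / 2

/-- The constant of `|σ_l'| ≤ K_σ'χ_lḡ_l²/g₀²`: `C(2 + 2K_z + Z + ZK_z)`. [cite: BauerschmidtBrydgesSlade2015Flow, Lemma 2.3 (proof, μ̄_j')] -/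
def sigmaDerivConst (C c20 : ℝ) : ℝ :=
  C * (2 + 2 * zDerivConst C c20 + 2 * C * c20 + 2 * C * c20 * zDerivConst C c20)

/-- The constant of the termwise bound `|(∏(λ-τ)⁻¹σ)'| ≤ K α^{l+1}χ_jḡ_j²/g₀²`:
`2α·C(1+K_z)·C_{2,0}·K_σ + 4K_σ'`. [cite: BauerschmidtBrydgesSlade2015Flow, Lemma 2.3 (proof, μ̄_j')] -/
def mubarDerivConst (C c20 α : ℝ) : ℝ :=
  2 * α * (C * (1 + zDerivConst C c20)) * c20 * sigmaConst C c20 + 4 * sigmaDerivConst C c20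

/-- `K_z ≥ 0`. [folklore] -/
theorem zDerivConst_nonneg {C c20 : ℝ} (hC : 0 ≤ C) (hc : 0 ≤ c20) : 0 ≤ zDerivConst C c20 := by
  unfold zDerivConst; positivity

/-- `K_σ ≥ 0`. [folklore] -/
theorem sigmaConst_nonneg {C c20 : ℝ} (hC : 0 ≤ C) (hc : 0 ≤ c20) : 0 ≤ sigmaConst C c20 := by
  unfold sigmaConst; positivity

/-- `K_σ' ≥ 0`. [folklore] -/
theorem sigmaDerivConst_nonneg {C c20 : ℝ} (hC : 0 ≤ C) (hc : 0 ≤ c20) : 0 ≤ sigmaDerivConst C c20 := by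
  have := zDerivConst_nonneg hC hc
  unfold sigmaDerivConst; positivity

/-- `K_μ' ≥ 0`. [folklore] -/
theorem mubarDerivConst_nonneg {C c20 α : ℝ} (hC : 0 ≤ C) (hc : 0 ≤ c20) (hα : 0 ≤ α) :
    0 ≤ mubarDerivConst C c20 α := by
  have := zDerivConst_nonneg hC hc
  have := sigmaConst_nonneg hC hc
  have := sigmaDerivConst_nonneg hC hc
  unfold mubarDerivConst; positivity

/-! ### `τ'`, `σ'`, `(∏(λ-τ)⁻¹)'`, `μ̄'` -/

namespace QuadFlowParams

variable (P : QuadFlowParams) (g₀ : ℝ)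

/-- `τ_n' = υ^{gμ}_nḡ_n' + υ^{zμ}_nz̄_n'`. [cite: BauerschmidtBrydgesSlade2015Flow, Lemma 2.3 (proof: τ_i')] -/
def tauDeriv (n : ℕ) : ℝ := P.υgμ n * gbarDeriv P.β g₀ n + P.υzμ n * P.zbarDeriv g₀ n

/-- `σ_n' = η_nḡ_n' + γ_nz̄_n' - υ^{gg}_n·2ḡ_nḡ_n' - (υ^{gz}_nḡ_n'z̄_n + υ^{gz}_nḡ_nz̄_n') - υ^{zz}_n·2z̄_nz̄_n'`.
[cite: BauerschmidtBrydgesSlade2015Flow, Lemma 2.3 (proof: σ_l')] -/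
def sigmaDeriv (n : ℕ) : ℝ :=
  P.η n * gbarDeriv P.β g₀ n + P.γ n * P.zbarDeriv g₀ n -
    P.υgg n * (2 * gbar P.β g₀ n * gbarDeriv P.β g₀ n) -
    (P.υgz n * gbarDeriv P.β g₀ n * P.zbar g₀ n + P.υgz n * gbar P.β g₀ n * P.zbarDeriv g₀ n) -
    P.υzz n * (2 * P.zbar g₀ n * P.zbarDeriv g₀ n)

/-- The logarithmic derivative of `∏_{k=j}^{j+l}(λ_k - τ_k)⁻¹`: `Σ_{i=0}^{l}τ_{i+j}'(λ_{i+j} - τ_{i+j})⁻¹`.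
[cite: BauerschmidtBrydgesSlade2015Flow, Lemma 2.3 (proof: Σ_{i=j}^l(λ_i - τ_i)⁻¹τ_i')] -/
def lamLogDeriv (j l : ℕ) : ℝ :=
  ∑ i ∈ Finset.range (l + 1), P.tauDeriv g₀ (i + j) * (P.lam (i + j) - P.tau g₀ (i + j))⁻¹

/-- `(∏_{k=j}^{j+l}(λ_k - τ_k)⁻¹)' = ∏(λ-τ)⁻¹ · Σ_i τ_i'(λ_i - τ_i)⁻¹`. [cite: BauerschmidtBrydgesSlade2015Flow, Lemma 2.3 (proof, μ̄_j')] -/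
def lamInvProdDeriv (j l : ℕ) : ℝ := P.lamInvProd g₀ j l * P.lamLogDeriv g₀ j l

/-- The `l`-th term of the series for `μ̄_j'`: `(∏(λ-τ)⁻¹)'σ_{l+j} + ∏(λ-τ)⁻¹σ_{l+j}'`.
[cite: BauerschmidtBrydgesSlade2015Flow, Lemma 2.3 (proof, μ̄_j')] -/
def mubarDerivTerm (j l : ℕ) : ℝ :=
  P.lamInvProdDeriv g₀ j l * P.sigma g₀ (l + j) + P.lamInvProd g₀ j l * P.sigmaDeriv g₀ (l + j)

/-- **`μ̄_j' = -Σ_l[(∏(λ_k - τ_k)⁻¹)'σ_l + ∏(λ_k - τ_k)⁻¹σ_l']`** (the derivative of (2.19) in `g₀`).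
[cite: BauerschmidtBrydgesSlade2015Flow, Lemma 2.3 (proof: μ̄_j' = -Σ_l(∏(λ_k-τ_k)⁻¹)(σ_l' + …))] -/
def mubarDeriv (j : ℕ) : ℝ := -∑' l, P.mubarDerivTerm g₀ j l

/-- `Σ^λ_{j,0} = τ_j'(λ_j - τ_j)⁻¹`. [cite: BauerschmidtBrydgesSlade2015Flow, Lemma 2.3 (proof)] -/
theorem lamLogDeriv_zero (j : ℕ) : P.lamLogDeriv g₀ j 0 = P.tauDeriv g₀ j * (P.lam j - P.tau g₀ j)⁻¹ := by
  simp [lamLogDeriv]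

/-- `Σ^λ_{j,l+1} = τ_j'(λ_j - τ_j)⁻¹ + Σ^λ_{j+1,l}`. [cite: BauerschmidtBrydgesSlade2015Flow, Lemma 2.3 (proof)] -/
theorem lamLogDeriv_succ (j l : ℕ) :
    P.lamLogDeriv g₀ j (l + 1) = P.tauDeriv g₀ j * (P.lam j - P.tau g₀ j)⁻¹ + P.lamLogDeriv g₀ (j + 1) l := by
  unfold lamLogDeriv
  rw [Finset.sum_range_succ' _ (l + 1), zero_add, add_comm]
  congr 1
  exact Finset.sum_congr rfl fun i _ => by rw [Nat.add_right_comm, Nat.add_assoc]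

end QuadFlowParams

section Mubar

variable {P : QuadFlowParams} {Ω : ℝ} {k : ℕ∞} {B c : ℝ} {N : ℕ} {C lam b : ℝ}

/-- `τ_n` is differentiable in `g₀ ∈ (0,b)` with derivative `tauDeriv`. [cite: BauerschmidtBrydgesSlade2015Flow, Lemma 2.3 (proof: τ_i')] -/
theorem hasDerivAt_tau (hb : CutoffQuadHyp P Ω k B c N C lam b)
    (hsmall : 8 * B ^ 2 * ((1 + N) / c + N + 2 * Ω / (Ω - 1)) * b ≤ 1) {x : ℝ} (hx0 : 0 < x)
    (hxb : x < b) (n : ℕ) : HasDerivAt (fun y => P.tau y n) (P.tauDeriv x n) x := by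
  have h1 := (hasDerivAt_gbar P.β n x).const_mul (P.υgμ n)
  have h2 := (hasDerivAt_zbar hb hsmall hx0 hxb n).const_mul (P.υzμ n)
  show HasDerivAt (fun y => P.υgμ n * gbar P.β y n + P.υzμ n * P.zbar y n)
    (P.υgμ n * gbarDeriv P.β x n + P.υzμ n * P.zbarDeriv x n) x
  exact h1.add h2

/-- `σ_n` is differentiable in `g₀ ∈ (0,b)` with derivative `sigmaDeriv`. [cite: BauerschmidtBrydgesSlade2015Flow, Lemma 2.3 (proof: σ_l')] -/
theorem hasDerivAt_sigma (hb : CutoffQuadHyp P Ω k B c N C lam b)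
    (hsmall : 8 * B ^ 2 * ((1 + N) / c + N + 2 * Ω / (Ω - 1)) * b ≤ 1) {x : ℝ} (hx0 : 0 < x)
    (hxb : x < b) (n : ℕ) : HasDerivAt (fun y => P.sigma y n) (P.sigmaDeriv x n) x := by
  have hg := hasDerivAt_gbar P.β n x
  have hz := hasDerivAt_zbar hb hsmall hx0 hxb n
  have t1 := hg.const_mul (P.η n)
  have t2 := hz.const_mul (P.γ n)
  have t3 := (hg.fun_pow 2).const_mul (P.υgg n)
  have t4 := (hg.const_mul (P.υgz n)).mul hz
  have t5 := (hz.fun_pow 2).const_mul (P.υzz n)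
  show HasDerivAt (fun y => P.η n * gbar P.β y n + P.γ n * P.zbar y n - P.υgg n * gbar P.β y n ^ 2 -
    P.υgz n * gbar P.β y n * P.zbar y n - P.υzz n * P.zbar y n ^ 2) (P.sigmaDeriv x n) x
  refine ((((t1.add t2).sub t3).sub t4).sub t5).congr_deriv ?_
  norm_num [QuadFlowParams.sigmaDeriv]

/-- The factors `λ_n - τ_n` are positive, hence nonzero. [cite: BauerschmidtBrydgesSlade2015Flow, Lemma 2.2, (2.18)] -/
theorem CutoffQuadHyp.lam_sub_tau_ne_zero {g₀ : ℝ} (h : CutoffQuadHyp P Ω k B c N C lam g₀) (n : ℕ) :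
    P.lam n - P.tau g₀ n ≠ 0 := by
  have h1 := h.lam_sub_tau_ge n
  have h2 := h.one_lt_lam
  exact ne_of_gt (by linarith)

/-- The derivative of a factor `(λ_n - τ_n)⁻¹` in `g₀`: `τ_n'(λ_n - τ_n)⁻²`. [cite: BauerschmidtBrydgesSlade2015Flow, Lemma 2.3 (proof, μ̄_j')] -/
theorem hasDerivAt_inv_lam_sub_tau (hb : CutoffQuadHyp P Ω k B c N C lam b)
    (hsmall : 8 * B ^ 2 * ((1 + N) / c + N + 2 * Ω / (Ω - 1)) * b ≤ 1) {x : ℝ} (hx0 : 0 < x)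
    (hxb : x < b) (n : ℕ) :
    HasDerivAt (fun y => (P.lam n - P.tau y n)⁻¹) (P.tauDeriv x n * (P.lam n - P.tau x n)⁻¹ ^ 2) x := by
  have hne : P.lam n - P.tau x n ≠ 0 := (hb.mono hx0 hxb.le).lam_sub_tau_ne_zero n
  have h1 : HasDerivAt (fun y => P.lam n - P.tau y n) (-(P.tauDeriv x n)) x :=
    (hasDerivAt_tau hb hsmall hx0 hxb n).const_sub (P.lam n)
  have h2 : HasDerivAt (fun y => (P.lam n - P.tau y n)⁻¹)
      (-(-(P.tauDeriv x n)) / (P.lam n - P.tau x n) ^ 2) x := HasDerivAt.inv h1 hne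
  refine h2.congr_deriv ?_
  rw [neg_neg, inv_pow, div_eq_mul_inv]

/-- **`∏_{k=j}^{j+l}(λ_k - τ_k)⁻¹` is differentiable in `g₀`** with derivative `lamInvProdDeriv`.
[cite: BauerschmidtBrydgesSlade2015Flow, Lemma 2.3 (proof, μ̄_j')] -/
theorem hasDerivAt_lamInvProd (hb : CutoffQuadHyp P Ω k B c N C lam b)
    (hsmall : 8 * B ^ 2 * ((1 + N) / c + N + 2 * Ω / (Ω - 1)) * b ≤ 1) {x : ℝ} (hx0 : 0 < x)
    (hxb : x < b) (j l : ℕ) :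
    HasDerivAt (fun y => P.lamInvProd y j l) (P.lamInvProdDeriv x j l) x := by
  induction l generalizing j with
  | zero =>
    have e : (fun y => P.lamInvProd y j 0) = fun y => (P.lam j - P.tau y j)⁻¹ :=
      funext fun y => P.lamInvProd_zero y j
    rw [e]
    refine (hasDerivAt_inv_lam_sub_tau hb hsmall hx0 hxb j).congr_deriv ?_
    simp only [QuadFlowParams.lamInvProdDeriv, QuadFlowParams.lamLogDeriv_zero,
      QuadFlowParams.lamInvProd_zero]
    ring
  | succ l ih =>
    have e : (fun y => P.lamInvProd y j (l + 1)) =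
        fun y => (P.lam j - P.tau y j)⁻¹ * P.lamInvProd y (j + 1) l :=
      funext fun y => P.lamInvProd_succ y j l
    rw [e]
    refine ((hasDerivAt_inv_lam_sub_tau hb hsmall hx0 hxb j).mul (ih (j + 1))).congr_deriv ?_
    simp only [QuadFlowParams.lamInvProdDeriv, QuadFlowParams.lamLogDeriv_succ,
      QuadFlowParams.lamInvProd_succ]
    ring

/-- The `l`-th term of (2.19) is differentiable in `g₀` with derivative `mubarDerivTerm`.
[cite: BauerschmidtBrydgesSlade2015Flow, Lemma 2.3 (proof, μ̄_j')] -/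
theorem hasDerivAt_mubarTerm (hb : CutoffQuadHyp P Ω k B c N C lam b)
    (hsmall : 8 * B ^ 2 * ((1 + N) / c + N + 2 * Ω / (Ω - 1)) * b ≤ 1) {x : ℝ} (hx0 : 0 < x)
    (hxb : x < b) (j l : ℕ) :
    HasDerivAt (fun y => P.lamInvProd y j l * P.sigma y (l + j)) (P.mubarDerivTerm x j l) x :=
  (hasDerivAt_lamInvProd hb hsmall hx0 hxb j l).mul (hasDerivAt_sigma hb hsmall hx0 hxb (l + j))

/-! #### Bounds at a point -/

namespace CutoffQuadHyp

variable {g₀ : ℝ} (h : CutoffQuadHyp P Ω k B c N C lam g₀)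
include h

/-- `|z̄_j'| ≤ K_zχ_jḡ_j²/g₀²` with the named constant. [cite: BauerschmidtBrydgesSlade2015Flow, Lemma 2.3, (2.33)] -/
theorem abs_zbarDeriv_le' (hsmall : 8 * B ^ 2 * ((1 + N) / c + N + 2 * Ω / (Ω - 1)) * g₀ ≤ 1) (j : ℕ) :
    |P.zbarDeriv g₀ j| ≤ zDerivConst C ((1 + N) / c + N + 2 * Ω / (Ω - 1)) *
      (cutoffWeight Ω k j * gbar P.β g₀ j ^ 2) / g₀ ^ 2 :=
  h.abs_zbarDeriv_le hsmall j

/-- **`|τ_n'| ≤ C(1 + K_z)χ_nḡ_n²/g₀²`**. [cite: BauerschmidtBrydgesSlade2015Flow, Lemma 2.3 (proof: bounds for ḡ', z̄' ⇒ τ_i')] -/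
theorem abs_tauDeriv_le (hsmall : 8 * B ^ 2 * ((1 + N) / c + N + 2 * Ω / (Ω - 1)) * g₀ ≤ 1) (n : ℕ) :
    |P.tauDeriv g₀ n| ≤ C * (1 + zDerivConst C ((1 + N) / c + N + 2 * Ω / (Ω - 1))) *
      (cutoffWeight Ω k n * gbar P.β g₀ n ^ 2) / g₀ ^ 2 := by
  have hG := h.toCutoffGbarHyp
  have hg := hG.g₀_pos
  have hC := h.C_nonneg
  have hKz := zDerivConst_nonneg hC hG.C20_nonneg
  set Kz := zDerivConst C ((1 + N) / c + N + 2 * Ω / (Ω - 1)) with hKzdef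
  have hw := (hG.weight_pos n).le
  have hw1 := hG.weight_le_one n
  have hgn := (hG.gbar_pos n).le
  have hd := hG.abs_gbarDeriv_le hsmall n
  have hz' := h.abs_zbarDeriv_le' hsmall n
  have h1 : |P.υgμ n * gbarDeriv P.β g₀ n| ≤ C * cutoffWeight Ω k n * (gbar P.β g₀ n / g₀) ^ 2 := by
    rw [abs_mul]
    exact mul_le_mul (h.υgμ_le n) hd (abs_nonneg _) (mul_nonneg hC hw)
  have h2 : |P.υzμ n * P.zbarDeriv g₀ n| ≤
      C * cutoffWeight Ω k n * (Kz * (cutoffWeight Ω k n * gbar P.β g₀ n ^ 2) / g₀ ^ 2) := by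
    rw [abs_mul]
    exact mul_le_mul (h.υzμ_le n) hz' (abs_nonneg _) (mul_nonneg hC hw)
  unfold QuadFlowParams.tauDeriv
  refine (abs_add_le _ _).trans ((add_le_add h1 h2).trans ?_)
  have e : C * cutoffWeight Ω k n * (gbar P.β g₀ n / g₀) ^ 2 +
      C * cutoffWeight Ω k n * (Kz * (cutoffWeight Ω k n * gbar P.β g₀ n ^ 2) / g₀ ^ 2) =
      C * (1 + Kz * cutoffWeight Ω k n) * (cutoffWeight Ω k n * gbar P.β g₀ n ^ 2) / g₀ ^ 2 := by
    rw [div_pow]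
    ring
  rw [e]
  refine div_le_div_of_nonneg_right (mul_le_mul_of_nonneg_right ?_ (by positivity)) (by positivity)
  refine mul_le_mul_of_nonneg_left ?_ hC
  nlinarith [mul_le_of_le_one_right hKz hw1]

/-- **`|σ_n'| ≤ K_σ'χ_nḡ_n²/g₀²`**, `K_σ' = C(2 + 2K_z + Z + ZK_z)`.
[cite: BauerschmidtBrydgesSlade2015Flow, Lemma 2.3 (proof: "etatau, zbarbd, and the bounds just proved for ḡ' and z̄'")] -/
theorem abs_sigmaDeriv_le (hsmall : 8 * B ^ 2 * ((1 + N) / c + N + 2 * Ω / (Ω - 1)) * g₀ ≤ 1) (n : ℕ) :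
    |P.sigmaDeriv g₀ n| ≤ sigmaDerivConst C ((1 + N) / c + N + 2 * Ω / (Ω - 1)) *
      (cutoffWeight Ω k n * gbar P.β g₀ n ^ 2) / g₀ ^ 2 := by
  have hG := h.toCutoffGbarHyp
  have hg := hG.g₀_pos
  have hC := h.C_nonneg
  have hC20 := hG.C20_nonneg
  have hKz := zDerivConst_nonneg hC hC20
  have hw := (hG.weight_pos n).le
  have hw1 := hG.weight_le_one n
  have hgn := (hG.gbar_pos n).le
  have hg12 := hG.gbar_le_half n
  have hd := hG.abs_gbarDeriv_le hsmall n
  have hz' := h.abs_zbarDeriv_le' hsmall n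
  have hz := h.abs_zbar_le n
  set c20 : ℝ := (1 + N) / c + N + 2 * Ω / (Ω - 1) with hc20
  set Kz := zDerivConst C c20 with hKzdef
  set Z : ℝ := 2 * C * c20 with hZ
  have hZ0 : 0 ≤ Z := by positivity
  -- abbreviations for the two basic sizes
  set G2 : ℝ := cutoffWeight Ω k n * gbar P.β g₀ n ^ 2 / g₀ ^ 2 with hG2
  have hG20 : 0 ≤ G2 := by positivity
  have hd' : |gbarDeriv P.β g₀ n| ≤ gbar P.β g₀ n ^ 2 / g₀ ^ 2 := by rwa [div_pow] at hd
  have hzD : |P.zbarDeriv g₀ n| ≤ Kz * G2 := by rw [hG2, ← mul_div_assoc]; exact hz'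
  have hzB : |P.zbar g₀ n| ≤ Z * (cutoffWeight Ω k n * gbar P.β g₀ n) := hz
  -- the six terms
  have e1 : |P.η n * gbarDeriv P.β g₀ n| ≤ C * G2 := by
    rw [abs_mul, hG2]
    calc |P.η n| * |gbarDeriv P.β g₀ n| ≤ (C * cutoffWeight Ω k n) * (gbar P.β g₀ n ^ 2 / g₀ ^ 2) :=
          mul_le_mul (h.eta_le n) hd' (abs_nonneg _) (mul_nonneg hC hw)
      _ = _ := by ring
  have e2 : |P.γ n * P.zbarDeriv g₀ n| ≤ C * Kz * G2 := by
    rw [abs_mul]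
    calc |P.γ n| * |P.zbarDeriv g₀ n| ≤ (C * cutoffWeight Ω k n) * (Kz * G2) :=
          mul_le_mul (h.gamma_le n) hzD (abs_nonneg _) (mul_nonneg hC hw)
      _ ≤ C * 1 * (Kz * G2) := by gcongr
      _ = _ := by ring
  have e3 : |P.υgg n * (2 * gbar P.β g₀ n * gbarDeriv P.β g₀ n)| ≤ C * G2 := by
    rw [abs_mul, abs_mul, abs_of_nonneg (by positivity : (0 : ℝ) ≤ 2 * gbar P.β g₀ n)]
    calc |P.υgg n| * (2 * gbar P.β g₀ n * |gbarDeriv P.β g₀ n|)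
        ≤ (C * cutoffWeight Ω k n) * (2 * gbar P.β g₀ n * (gbar P.β g₀ n ^ 2 / g₀ ^ 2)) :=
          mul_le_mul (h.υgg_le n) (mul_le_mul_of_nonneg_left hd' (by positivity)) (by positivity)
            (mul_nonneg hC hw)
      _ = (2 * gbar P.β g₀ n) * (C * G2) := by rw [hG2]; ring
      _ ≤ 1 * (C * G2) := by gcongr; linarith
      _ = _ := one_mul _
  have e4 : |P.υgz n * gbarDeriv P.β g₀ n * P.zbar g₀ n| ≤ C * Z * G2 := by
    rw [abs_mul, abs_mul]
    calc |P.υgz n| * |gbarDeriv P.β g₀ n| * |P.zbar g₀ n|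
        ≤ (C * cutoffWeight Ω k n) * (gbar P.β g₀ n ^ 2 / g₀ ^ 2) * (Z * (cutoffWeight Ω k n * gbar P.β g₀ n)) :=
          mul_le_mul (mul_le_mul (h.υgz_le n) hd' (abs_nonneg _) (mul_nonneg hC hw)) hzB (abs_nonneg _)
            (by positivity)
      _ = (cutoffWeight Ω k n * gbar P.β g₀ n) * (C * Z * G2) := by rw [hG2]; ring
      _ ≤ 1 * (C * Z * G2) := by
          gcongr
          calc cutoffWeight Ω k n * gbar P.β g₀ n ≤ 1 * (1 / 2) := mul_le_mul hw1 hg12 hgn zero_le_one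
            _ ≤ 1 := by norm_num
      _ = _ := one_mul _
  have e5 : |P.υgz n * gbar P.β g₀ n * P.zbarDeriv g₀ n| ≤ C * Kz * G2 := by
    rw [abs_mul, abs_mul, abs_of_nonneg hgn]
    calc |P.υgz n| * gbar P.β g₀ n * |P.zbarDeriv g₀ n| ≤ (C * cutoffWeight Ω k n) * (1 / 2) * (Kz * G2) :=
          mul_le_mul (mul_le_mul (h.υgz_le n) hg12 hgn (mul_nonneg hC hw)) hzD (abs_nonneg _) (by positivity)
      _ ≤ C * 1 * (1 / 2) * (Kz * G2) := by gcongr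
      _ ≤ _ := by nlinarith [mul_nonneg (mul_nonneg hC hKz) hG20]
  have e6 : |P.υzz n * (2 * P.zbar g₀ n * P.zbarDeriv g₀ n)| ≤ C * Z * Kz * G2 := by
    rw [abs_mul, abs_mul, abs_mul, abs_two]
    calc |P.υzz n| * (2 * |P.zbar g₀ n| * |P.zbarDeriv g₀ n|)
        ≤ (C * cutoffWeight Ω k n) * (2 * (Z * (cutoffWeight Ω k n * gbar P.β g₀ n)) * (Kz * G2)) :=
          mul_le_mul (h.υzz_le n) (mul_le_mul (mul_le_mul_of_nonneg_left hzB zero_le_two) hzD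
            (abs_nonneg _) (by positivity)) (by positivity) (mul_nonneg hC hw)
      _ = (cutoffWeight Ω k n * (2 * (cutoffWeight Ω k n * gbar P.β g₀ n))) * (C * Z * Kz * G2) := by ring
      _ ≤ 1 * (C * Z * Kz * G2) := by
          gcongr
          calc cutoffWeight Ω k n * (2 * (cutoffWeight Ω k n * gbar P.β g₀ n))
              ≤ 1 * (2 * (1 * (1 / 2))) := by gcongr
            _ = 1 := by norm_num
      _ = _ := one_mul _
  unfold QuadFlowParams.sigmaDeriv
  calc |P.η n * gbarDeriv P.β g₀ n + P.γ n * P.zbarDeriv g₀ n -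
        P.υgg n * (2 * gbar P.β g₀ n * gbarDeriv P.β g₀ n) -
        (P.υgz n * gbarDeriv P.β g₀ n * P.zbar g₀ n + P.υgz n * gbar P.β g₀ n * P.zbarDeriv g₀ n) -
        P.υzz n * (2 * P.zbar g₀ n * P.zbarDeriv g₀ n)|
      ≤ C * G2 + C * Kz * G2 + C * G2 + (C * Z * G2 + C * Kz * G2) + C * Z * Kz * G2 :=
        abs_sub_le_of_le' (abs_sub_le_of_le' (abs_sub_le_of_le' (abs_add_le_of_le' e1 e2) e3)
          (abs_add_le_of_le' e4 e5)) e6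
    _ = sigmaDerivConst C c20 * (cutoffWeight Ω k n * gbar P.β g₀ n ^ 2) / g₀ ^ 2 := by
        rw [hG2, sigmaDerivConst, hZ]
        ring

/-- **`|Σ^λ_{j,l}| ≤ αC(1+K_z)C_{2,0}χ_jḡ_j/g₀²`**, `α = 2/(1+λ)`. [cite: BauerschmidtBrydgesSlade2015Flow, Lemma 2.3 (proof: Σ_i(λ_i-τ_i)⁻¹τ_i')] -/
theorem abs_lamLogDeriv_le (hsmall : 8 * B ^ 2 * ((1 + N) / c + N + 2 * Ω / (Ω - 1)) * g₀ ≤ 1) (j l : ℕ) :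
    |P.lamLogDeriv g₀ j l| ≤ (2 / (1 + lam)) * (C * (1 + zDerivConst C ((1 + N) / c + N + 2 * Ω / (Ω - 1)))) *
      ((1 + N) / c + N + 2 * Ω / (Ω - 1)) * (cutoffWeight Ω k j * gbar P.β g₀ j) / g₀ ^ 2 := by
  have hG := h.toCutoffGbarHyp
  have hg := hG.g₀_pos
  have hC := h.C_nonneg
  have hC20 := hG.C20_nonneg
  have hKz := zDerivConst_nonneg hC hC20
  obtain ⟨hα0, -⟩ := h.alpha_mem
  set α : ℝ := 2 / (1 + lam) with hα
  set Kτ : ℝ := C * (1 + zDerivConst C ((1 + N) / c + N + 2 * Ω / (Ω - 1))) with hKτ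
  have hKτ0 : 0 ≤ Kτ := by positivity
  unfold QuadFlowParams.lamLogDeriv
  have hterm : ∀ i, |P.tauDeriv g₀ (i + j) * (P.lam (i + j) - P.tau g₀ (i + j))⁻¹| ≤
      α * Kτ / g₀ ^ 2 * (cutoffWeight Ω k (i + j) * gbar P.β g₀ (i + j) ^ 2) := fun i => by
    obtain ⟨hf0, hfα⟩ := h.inv_lam_sub_tau_mem (i + j)
    have ht := h.abs_tauDeriv_le hsmall (i + j)
    have hw := (hG.weight_pos (i + j)).le
    rw [abs_mul, abs_of_nonneg hf0]
    calc |P.tauDeriv g₀ (i + j)| * (P.lam (i + j) - P.tau g₀ (i + j))⁻¹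
        ≤ (Kτ * (cutoffWeight Ω k (i + j) * gbar P.β g₀ (i + j) ^ 2) / g₀ ^ 2) * α :=
          mul_le_mul ht hfα hf0 (by positivity)
      _ = _ := by ring
  calc |∑ i ∈ Finset.range (l + 1), P.tauDeriv g₀ (i + j) * (P.lam (i + j) - P.tau g₀ (i + j))⁻¹|
      ≤ ∑ i ∈ Finset.range (l + 1), |P.tauDeriv g₀ (i + j) * (P.lam (i + j) - P.tau g₀ (i + j))⁻¹| :=
        Finset.abs_sum_le_sum_abs _ _
    _ ≤ ∑ i ∈ Finset.range (l + 1), α * Kτ / g₀ ^ 2 * (cutoffWeight Ω k (i + j) * gbar P.β g₀ (i + j) ^ 2) :=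
        Finset.sum_le_sum fun i _ => hterm i
    _ = α * Kτ / g₀ ^ 2 * ∑ m ∈ Finset.Icc j (j + l), cutoffWeight Ω k m * gbar P.β g₀ m ^ 2 := by
        rw [← Finset.mul_sum, sum_range_shift_eq_sum_Icc (fun m => cutoffWeight Ω k m * gbar P.β g₀ m ^ 2)]
    _ ≤ α * Kτ / g₀ ^ 2 * (((1 + N) / c + N + 2 * Ω / (Ω - 1)) * (cutoffWeight Ω k j * gbar P.β g₀ j)) :=
        mul_le_mul_of_nonneg_left (hG.sum_weight_mul_gbar_sq_le j (j + l)) (by positivity)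
    _ = _ := by rw [hα, hKτ]; field_simp

/-- **`|(∏_{k=j}^{j+l}(λ_k - τ_k)⁻¹)'| ≤ α^{l+1}·αC(1+K_z)C_{2,0}χ_jḡ_j/g₀²`**.
[cite: BauerschmidtBrydgesSlade2015Flow, Lemma 2.3 (proof: "The first product is bounded by α^{l-j+1}")] -/
theorem abs_lamInvProdDeriv_le (hsmall : 8 * B ^ 2 * ((1 + N) / c + N + 2 * Ω / (Ω - 1)) * g₀ ≤ 1) (j l : ℕ) :
    |P.lamInvProdDeriv g₀ j l| ≤ (2 / (1 + lam)) ^ (l + 1) *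
      ((2 / (1 + lam)) * (C * (1 + zDerivConst C ((1 + N) / c + N + 2 * Ω / (Ω - 1)))) *
        ((1 + N) / c + N + 2 * Ω / (Ω - 1)) * (cutoffWeight Ω k j * gbar P.β g₀ j) / g₀ ^ 2) := by
  obtain ⟨h0, h1⟩ := h.lamInvProd_mem j l
  have hS := h.abs_lamLogDeriv_le hsmall j l
  unfold QuadFlowParams.lamInvProdDeriv
  rw [abs_mul, abs_of_nonneg h0]
  exact mul_le_mul h1 hS (abs_nonneg _) (pow_nonneg h.alpha_mem.1 _)

/-- `χ_{l+j}ḡ_{l+j} ≤ 2χ_jḡ_j` and `χ_{l+j}ḡ_{l+j}² ≤ 4χ_jḡ_j²` (monotonicity of the weights,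
`ḡ_l ≤ 2ḡ_j`). [cite: BauerschmidtBrydgesSlade2015Flow, Lemma 2.1(i), (2.2)] -/
theorem weight_gbar_shift_le (j l : ℕ) :
    cutoffWeight Ω k (l + j) * gbar P.β g₀ (l + j) ≤ 2 * (cutoffWeight Ω k j * gbar P.β g₀ j) ∧
      cutoffWeight Ω k (l + j) * gbar P.β g₀ (l + j) ^ 2 ≤ 4 * (cutoffWeight Ω k j * gbar P.β g₀ j ^ 2) := by
  have hG := h.toCutoffGbarHyp
  have h1 := hG.gbar_le_two_mul (Nat.le_add_left j l)
  have h2 := cutoffWeight_antitone hG.one_le k (Nat.le_add_left j l)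
  have hg := (hG.gbar_pos (l + j)).le
  have hw := (hG.weight_pos j).le
  constructor
  · calc cutoffWeight Ω k (l + j) * gbar P.β g₀ (l + j) ≤ cutoffWeight Ω k j * (2 * gbar P.β g₀ j) :=
          mul_le_mul h2 h1 hg hw
      _ = _ := by ring
  · calc cutoffWeight Ω k (l + j) * gbar P.β g₀ (l + j) ^ 2 ≤ cutoffWeight Ω k j * (2 * gbar P.β g₀ j) ^ 2 :=
          mul_le_mul h2 (pow_le_pow_left₀ hg h1 2) (sq_nonneg _) hw
      _ = _ := by ring

/-- **Termwise bound for `μ̄_j'`**: `|(∏(λ-τ)⁻¹)'σ_{l+j} + ∏(λ-τ)⁻¹σ_{l+j}'| ≤ K_μ'α^{l+1}χ_jḡ_j²/g₀²`,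
`K_μ' = mubarDerivConst`. [cite: BauerschmidtBrydgesSlade2015Flow, Lemma 2.3 (proof, μ̄_j')] -/
theorem abs_mubarDerivTerm_le (hsmall : 8 * B ^ 2 * ((1 + N) / c + N + 2 * Ω / (Ω - 1)) * g₀ ≤ 1) (j l : ℕ) :
    |P.mubarDerivTerm g₀ j l| ≤
      mubarDerivConst C ((1 + N) / c + N + 2 * Ω / (Ω - 1)) (2 / (1 + lam)) * (2 / (1 + lam)) ^ (l + 1) *
        (cutoffWeight Ω k j * gbar P.β g₀ j ^ 2) / g₀ ^ 2 := by
  have hG := h.toCutoffGbarHyp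
  have hg := hG.g₀_pos
  have hC := h.C_nonneg
  have hC20 := hG.C20_nonneg
  have hKz := zDerivConst_nonneg hC hC20
  obtain ⟨hα0, -⟩ := h.alpha_mem
  have hKσ := sigmaConst_nonneg hC hC20
  have hKσ' := sigmaDerivConst_nonneg hC hC20
  obtain ⟨hP0, hP1⟩ := h.lamInvProd_mem j l
  have hΛ' := h.abs_lamInvProdDeriv_le hsmall j l
  have hσ' := h.abs_sigmaDeriv_le hsmall (l + j)
  obtain ⟨hs1, hs2⟩ := h.weight_gbar_shift_le j l
  have hwj := (hG.weight_pos j).le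
  have hwj1 := hG.weight_le_one j
  have hgj := (hG.gbar_pos j).le
  set c20 : ℝ := (1 + N) / c + N + 2 * Ω / (Ω - 1) with hc20
  set α : ℝ := 2 / (1 + lam) with hα
  set Kτ : ℝ := C * (1 + zDerivConst C c20) with hKτ
  have hKτ0 : 0 ≤ Kτ := by positivity
  have hσ : |P.sigma g₀ (l + j)| ≤ sigmaConst C c20 * (cutoffWeight Ω k (l + j) * gbar P.β g₀ (l + j)) :=
    h.abs_sigma_le (l + j)
  unfold QuadFlowParams.mubarDerivTerm
  refine (abs_add_le _ _).trans ?_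
  rw [abs_mul, abs_mul, abs_of_nonneg hP0]
  have t1 : |P.lamInvProdDeriv g₀ j l| * |P.sigma g₀ (l + j)| ≤
      (α ^ (l + 1) * (α * Kτ * c20 * (cutoffWeight Ω k j * gbar P.β g₀ j) / g₀ ^ 2)) *
        (sigmaConst C c20 * (2 * (cutoffWeight Ω k j * gbar P.β g₀ j))) :=
    mul_le_mul hΛ' (hσ.trans (mul_le_mul_of_nonneg_left hs1 hKσ)) (abs_nonneg _) (by positivity)
  have t2 : P.lamInvProd g₀ j l * |P.sigmaDeriv g₀ (l + j)| ≤
      α ^ (l + 1) * (sigmaDerivConst C c20 * (4 * (cutoffWeight Ω k j * gbar P.β g₀ j ^ 2)) / g₀ ^ 2) :=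
    mul_le_mul hP1 (hσ'.trans (div_le_div_of_nonneg_right (mul_le_mul_of_nonneg_left hs2 hKσ')
      (by positivity))) (abs_nonneg _) (pow_nonneg hα0 _)
  refine (add_le_add t1 t2).trans ?_
  have e : α ^ (l + 1) * (α * Kτ * c20 * (cutoffWeight Ω k j * gbar P.β g₀ j) / g₀ ^ 2) *
        (sigmaConst C c20 * (2 * (cutoffWeight Ω k j * gbar P.β g₀ j))) +
      α ^ (l + 1) * (sigmaDerivConst C c20 * (4 * (cutoffWeight Ω k j * gbar P.β g₀ j ^ 2)) / g₀ ^ 2) =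
      (2 * α * Kτ * c20 * sigmaConst C c20 * cutoffWeight Ω k j + 4 * sigmaDerivConst C c20) * α ^ (l + 1) *
        (cutoffWeight Ω k j * gbar P.β g₀ j ^ 2) / g₀ ^ 2 := by
    ring
  rw [e, mubarDerivConst, ← hKτ]
  refine div_le_div_of_nonneg_right (mul_le_mul_of_nonneg_right (mul_le_mul_of_nonneg_right ?_
    (pow_nonneg hα0 _)) (by positivity)) (by positivity)
  nlinarith [mul_le_of_le_one_right (by positivity : 0 ≤ 2 * α * Kτ * c20 * sigmaConst C c20) hwj1]

end CutoffQuadHyp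

/-- **[BBS-rg-flow, Lemma 2.3] for `μ̄`: `μ̄_j` is differentiable in the initial condition**, with
derivative `mubarDeriv` (termwise differentiation of (2.19)), for `g₀ ∈ (0,b)`.
[cite: BauerschmidtBrydgesSlade2015Flow, Lemma 2.3 (proof, μ̄_j')] -/
theorem hasDerivAt_mubar (hb : CutoffQuadHyp P Ω k B c N C lam b)
    (hsmall : 8 * B ^ 2 * ((1 + N) / c + N + 2 * Ω / (Ω - 1)) * b ≤ 1) {g : ℝ} (hg : 0 < g)
    (hgb : g < b) (j : ℕ) : HasDerivAt (fun x => P.mubar x j) (P.mubarDeriv g j) g := by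
  have hGb := hb.toCutoffGbarHyp
  have hC := hb.C_nonneg
  have hC20 := hGb.C20_nonneg
  obtain ⟨hα0, hα1⟩ := hb.alpha_mem
  have ha0 : 0 < g / 2 := by positivity
  have hsm : ∀ x : ℝ, x ≤ b → 8 * B ^ 2 * ((1 + N) / c + N + 2 * Ω / (Ω - 1)) * x ≤ 1 := fun x hx =>
    le_trans (mul_le_mul_of_nonneg_left hx (mul_nonneg (by positivity) hC20)) hsmall
  have hyp : ∀ x ∈ Ioo (g / 2) b, CutoffQuadHyp P Ω k B c N C lam x := fun x hx =>
    hb.mono (ha0.trans hx.1) hx.2.le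
  have hmono : ∀ x ∈ Ioo (g / 2) b, ∀ n, gbar P.β x n ≤ gbar P.β b n := fun x hx n =>
    hGb.gbar_mono_init hsmall n (ha0.trans hx.1) hx.2.le le_rfl
  set M : ℝ := mubarDerivConst C ((1 + N) / c + N + 2 * Ω / (Ω - 1)) (2 / (1 + lam)) with hM
  have hM0 : 0 ≤ M := mubarDerivConst_nonneg hC hC20 hα0
  set A : ℝ := M * (cutoffWeight Ω k j * gbar P.β b j ^ 2) / (g / 2) ^ 2 with hA
  have hu_sum : Summable fun l => A * (2 / (1 + lam)) ^ (l + 1) :=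
    ((summable_geometric_of_lt_one hα0 hα1).mul_left (A * (2 / (1 + lam)))).congr fun l => by ring
  have hmain := hasDerivAt_tsum_of_isPreconnected (t := Ioo (g / 2) b) (y₀ := g) hu_sum isOpen_Ioo
    isPreconnected_Ioo (fun l x hx => hasDerivAt_mubarTerm hb hsmall (ha0.trans hx.1) hx.2 j l)
    (fun l x hx => ?_) ⟨by linarith, hgb⟩ ((hb.mono hg hgb.le).summable_mubar_term j) ⟨by linarith, hgb⟩
  · show HasDerivAt (fun x => -∑' l, P.lamInvProd x j l * P.sigma x (l + j)) (-∑' l, P.mubarDerivTerm g j l) g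
    exact hmain.neg
  -- the termwise bound at `x`, then monotonicity in `x`
  have hx0 : 0 < x := ha0.trans hx.1
  have hGx := (hyp x hx).toCutoffGbarHyp
  have hwj := (hGx.weight_pos j).le
  have hgj := (hGx.gbar_pos j).le
  have hx2 : (g / 2) ^ 2 ≤ x ^ 2 := pow_le_pow_left₀ ha0.le hx.1.le 2
  have hnum : M * (2 / (1 + lam)) ^ (l + 1) * (cutoffWeight Ω k j * gbar P.β x j ^ 2) ≤
      M * (2 / (1 + lam)) ^ (l + 1) * (cutoffWeight Ω k j * gbar P.β b j ^ 2) := by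
    have := hmono x hx j
    gcongr
  rw [Real.norm_eq_abs]
  calc |P.mubarDerivTerm x j l|
      ≤ M * (2 / (1 + lam)) ^ (l + 1) * (cutoffWeight Ω k j * gbar P.β x j ^ 2) / x ^ 2 :=
        (hyp x hx).abs_mubarDerivTerm_le (hsm x hx.2.le) j l
    _ ≤ M * (2 / (1 + lam)) ^ (l + 1) * (cutoffWeight Ω k j * gbar P.β b j ^ 2) / x ^ 2 :=
        div_le_div_of_nonneg_right hnum (by positivity)
    _ ≤ M * (2 / (1 + lam)) ^ (l + 1) * (cutoffWeight Ω k j * gbar P.β b j ^ 2) / (g / 2) ^ 2 :=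
        div_le_div_of_nonneg_left (by positivity) (by positivity) hx2
    _ = A * (2 / (1 + lam)) ^ (l + 1) := by rw [hA]; ring

/-- **[BBS-rg-flow, Lemma 2.3, (2.33) for `μ̄`]: `|μ̄_j'| ≤ K_μχ_jḡ_j²/g₀²`**,
`K_μ = mubarDerivConst · α/(1-α)` ("`|μ̄_j'| ≤ O(χ_jḡ_j²ḡ₀⁻²)`").
[cite: BauerschmidtBrydgesSlade2015Flow, Lemma 2.3, (2.33)] -/
theorem CutoffQuadHyp.abs_mubarDeriv_le {g₀ : ℝ} (h : CutoffQuadHyp P Ω k B c N C lam g₀)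
    (hsmall : 8 * B ^ 2 * ((1 + N) / c + N + 2 * Ω / (Ω - 1)) * g₀ ≤ 1) (j : ℕ) :
    |P.mubarDeriv g₀ j| ≤
      mubarDerivConst C ((1 + N) / c + N + 2 * Ω / (Ω - 1)) (2 / (1 + lam)) *
        ((2 / (1 + lam)) / (1 - 2 / (1 + lam))) * (cutoffWeight Ω k j * gbar P.β g₀ j ^ 2) / g₀ ^ 2 := by
  have hG := h.toCutoffGbarHyp
  have hg := hG.g₀_pos
  have hC := h.C_nonneg
  have hC20 := hG.C20_nonneg
  obtain ⟨hα0, hα1⟩ := h.alpha_mem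
  set α : ℝ := 2 / (1 + lam) with hα
  set M : ℝ := mubarDerivConst C ((1 + N) / c + N + 2 * Ω / (Ω - 1)) α with hM
  have hM0 : 0 ≤ M := mubarDerivConst_nonneg hC hC20 hα0
  have hwj := (hG.weight_pos j).le
  have hgj := (hG.gbar_pos j).le
  set A : ℝ := M * (cutoffWeight Ω k j * gbar P.β g₀ j ^ 2) / g₀ ^ 2 with hA
  have hA0 : 0 ≤ A := by positivity
  have hgeo : HasSum (fun l : ℕ => α ^ (l + 1)) (α / (1 - α)) := by
    have h1 := (hasSum_geometric_of_lt_one hα0 hα1).mul_left α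
    simp only [← pow_succ'] at h1
    rwa [div_eq_mul_inv]
  have hv_sum : Summable fun l => A * α ^ (l + 1) := hgeo.summable.mul_left A
  have hle : ∀ l, |P.mubarDerivTerm g₀ j l| ≤ A * α ^ (l + 1) := fun l => by
    refine (h.abs_mubarDerivTerm_le hsmall j l).trans (le_of_eq ?_)
    rw [hA, hM, hα]
    ring
  have hsum : Summable fun l => P.mubarDerivTerm g₀ j l :=
    Summable.of_norm_bounded hv_sum fun l => by rw [Real.norm_eq_abs]; exact hle l
  calc |P.mubarDeriv g₀ j| = |∑' l, P.mubarDerivTerm g₀ j l| := by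
        rw [QuadFlowParams.mubarDeriv, abs_neg]
    _ ≤ ∑' l, |P.mubarDerivTerm g₀ j l| := by
        have := norm_tsum_le_tsum_norm (f := fun l => P.mubarDerivTerm g₀ j l)
          (by simpa only [Real.norm_eq_abs] using hsum.abs)
        simpa only [Real.norm_eq_abs] using this
    _ ≤ ∑' l, A * α ^ (l + 1) := Summable.tsum_le_tsum hle hsum.abs hv_sum
    _ = A * (α / (1 - α)) := by rw [tsum_mul_left, hgeo.tsum_eq]
    _ = _ := by rw [hA]; ring

end Mubar

/-! ### The flow `V̄_j` -/

/-- **[BBS-rg-flow, Lemma 2.3] (first derivatives): `V̄_j = (ḡ_j, z̄_j, μ̄_j)` is differentiable in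
the initial condition `g₀ ∈ (0, b)`, with `|V̄_j'| ≤ Kχ_jḡ_j²/g₀²`** ((2.33): `ḡ_j' = O(ḡ_j²/ḡ₀²)`,
`z̄_j', μ̄_j' = O(χ_jḡ_j²/ḡ₀²)`; for `ḡ` the weight `χ_j ≤ 1` is dropped as printed), whenever
the hypotheses of Lemma 2.2 hold at `b` together with `8B²C_{2,0}b ≤ 1`. The derivative of the
flow is `(ḡ_j', z̄_j', μ̄_j') = (gbarDeriv, zbarDeriv, mubarDeriv)`.
[cite: BauerschmidtBrydgesSlade2015Flow, Lemma 2.3, (2.33)] [cite: BauerschmidtBrydgesSlade2015LogCorr, Proposition 6.1.1 ("V̄_j is continuously differentiable in the initial condition ḡ₀")] -/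
theorem hasDerivAt_flow {P : QuadFlowParams} {Ω : ℝ} {k : ℕ∞} {B c : ℝ} {N : ℕ} {C lam b : ℝ}
    (hb : CutoffQuadHyp P Ω k B c N C lam b)
    (hsmall : 8 * B ^ 2 * ((1 + N) / c + N + 2 * Ω / (Ω - 1)) * b ≤ 1) {g : ℝ} (hg : 0 < g)
    (hgb : g < b) (j : ℕ) :
    HasDerivAt (fun x => P.flow x j 0) (gbarDeriv P.β g j) g ∧
      HasDerivAt (fun x => P.flow x j 1) (P.zbarDeriv g j) g ∧
      HasDerivAt (fun x => P.flow x j 2) (P.mubarDeriv g j) g ∧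
      |gbarDeriv P.β g j| ≤ gbar P.β g j ^ 2 / g ^ 2 ∧
      |P.zbarDeriv g j| ≤ zDerivConst C ((1 + N) / c + N + 2 * Ω / (Ω - 1)) *
        (cutoffWeight Ω k j * gbar P.β g j ^ 2) / g ^ 2 ∧
      |P.mubarDeriv g j| ≤ mubarDerivConst C ((1 + N) / c + N + 2 * Ω / (Ω - 1)) (2 / (1 + lam)) *
        ((2 / (1 + lam)) / (1 - 2 / (1 + lam))) * (cutoffWeight Ω k j * gbar P.β g j ^ 2) / g ^ 2 := by
  have hgx := hb.mono hg hgb.le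
  have hC20 := hb.toCutoffGbarHyp.C20_nonneg
  have hsg : 8 * B ^ 2 * ((1 + N) / c + N + 2 * Ω / (Ω - 1)) * g ≤ 1 :=
    le_trans (mul_le_mul_of_nonneg_left hgb.le (mul_nonneg (by positivity) hC20)) hsmall
  refine ⟨?_, ?_, ?_, ?_, hgx.abs_zbarDeriv_le' hsg j, hgx.abs_mubarDeriv_le hsg j⟩
  · simpa only [QuadFlowParams.flow_apply_zero] using hasDerivAt_gbar P.β j g
  · simpa only [QuadFlowParams.flow_apply_one] using hasDerivAt_zbar hb hsmall hg hgb j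
  · simpa only [QuadFlowParams.flow_apply_two] using hasDerivAt_mubar hb hsmall hg hgb j
  · have := hgx.toCutoffGbarHyp.abs_gbarDeriv_le hsg j
    rwa [div_pow] at this


end CTWSAW

end Literature.Barriers.CriticalPhenomena
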